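import Literature.Analysis.Complex.HarmonicMaxPrincipleExceptional
import Mathlib.Analysis.SpecialFunctions.Complex.Arg
import Mathlib.Analysis.SpecialFunctions.Complex.Analytic
import Mathlib.Analysis.Complex.UpperHalfPlane.Topology
import HarnessLib

/-!
# Bounded harmonic functions on the half-plane with two-valued boundary data: the harmonic measure of a segment

Topic `Literature/Analysis/Complex` (harmonic functions; companion of
`HarmonicMaxPrincipleExceptional.lean`). Two classical items:

* **Lindelöf's maximum principle on the upper half-plane** (`harmonic_le_of_real_except`): a
  harmonic function on `ℍ` which is bounded above and has `lim sup ≤ M` at every real boundary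
  point outside a finite set is `≤ M` on `ℍ` (the point at infinity and the exceptional points
  are absorbed by the logarithmic barriers `log |z + i| ≥ 0` and `log |z - p|`).
* **The harmonic measure of the segment `[-1, 1]`** seen from `ℍ`,
  `ω(w) = (arg(w - 1) - arg(w + 1))/π` (`hmSeg`): harmonic on `ℍ`, bounded, with boundary
  values `1` on `(-1, 1)` and `0` on `|x| > 1`; and the **identification** (`eq_one_sub_hmSeg`):
  a bounded harmonic function on `ℍ` with boundary values `0` on `(-1, 1)` and `1` on `|x| > 1`
  (outside a finite exceptional set) is `1 - ω`.

Use: this is the continuum function of the three-arc mixed Dirichlet–Neumann problem of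
G. F. Lawler, O. Schramm, W. Werner, Ann. Probab. 32 (2004), Prop. 4.1 / Prop. 4.2 (arXiv
version p. 22: "Of course, we found the map `h` satisfying these boundary conditions by reflecting
the domain along the negative real axis, mapping this larger domain to `ℍ` with `z ↦ √z`, …"):
after `z = w²` and even reflection, `h(z) = 1 - ω(√z)`, and the identification above is what
pins down a subsequential scaling limit. Everything is proved.

## References

* M. Tsuji, *Potential Theory in Modern Function Theory* (1959), Thm. III.28; J. B. Conway,
  *Functions of One Complex Variable* (1978), Ch. X. [Conway1978]
* G. F. Lawler, O. Schramm, W. Werner, Ann. Probab. 32 (2004), §4.2 (arXiv p. 22).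
  [LawlerSchrammWerner2004]
-/

noncomputable section

open Set Filter Metric Topology Complex InnerProductSpace
open UpperHalfPlane (upperHalfPlaneSet)

namespace Literature.Analysis.Complex

/-! ### Lindelöf's maximum principle on the half-plane -/

/-- The barrier at infinity `log |z + i|` is nonnegative on the closed upper half-plane.
[folklore] -/
theorem log_norm_add_I_nonneg {z : ℂ} (hz : 0 ≤ z.im) : 0 ≤ Real.log ‖z + I‖ := by
  refine Real.log_nonneg ?_
  calc (1 : ℝ) ≤ (z + I).im := by simp; linarith
    _ ≤ |(z + I).im| := le_abs_self _
    _ ≤ ‖z + I‖ := Complex.abs_im_le_norm _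

/-- `log |z - p| ≤ log |z + i| + log (1 + |p + i|)` on the closed upper half-plane. [folklore] -/
theorem log_norm_sub_le {z : ℂ} (hz : 0 ≤ z.im) (p : ℂ) :
    Real.log ‖z - p‖ ≤ Real.log ‖z + I‖ + Real.log (1 + ‖p + I‖) := by
  have h1 : 1 ≤ ‖z + I‖ := by
    calc (1 : ℝ) ≤ (z + I).im := by simp; linarith
      _ ≤ |(z + I).im| := le_abs_self _
      _ ≤ ‖z + I‖ := Complex.abs_im_le_norm _
  rcases eq_or_ne (z - p) 0 with h0 | h0
  · rw [h0, norm_zero, Real.log_zero]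
    exact add_nonneg (Real.log_nonneg h1) (Real.log_nonneg (by linarith [norm_nonneg (p + I)]))
  · rw [← Real.log_mul (by linarith) (by positivity)]
    refine Real.log_le_log (norm_pos_iff.2 h0) ?_
    calc ‖z - p‖ = ‖(z + I) - (p + I)‖ := by ring_nf
      _ ≤ ‖z + I‖ + ‖p + I‖ := norm_sub_le _ _
      _ ≤ ‖z + I‖ + ‖z + I‖ * ‖p + I‖ := by
          gcongr
          exact le_mul_of_one_le_left (norm_nonneg _) h1
      _ = ‖z + I‖ * (1 + ‖p + I‖) := by ring

/-- **Lindelöf's maximum principle on the upper half-plane.** Let `u` be harmonic on `ℍ` and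
bounded above there, `E` a finite set of real numbers, and suppose `lim sup_{z → x, z ∈ ℍ} u ≤ M`
at every real `x ∉ E`. Then `u ≤ M` on `ℍ`. Proof: for `ε > 0` the function
`u + ε ∑_{p ∈ E} log |z - p| - ε (#E + 1) log |z + i|` is harmonic, exceeds `u` by at most
`ε C_E`, and tends to `-∞` at the points of `E` and at `∞`; the lim-sup maximum principle bounds
it by `M + ε C_E`, and `ε → 0`. [cite: Conway1978, Ch. X §1 (Maximum Principle)] -/
theorem harmonic_le_of_real_except {u : ℂ → ℝ} (hu : HarmonicOnNhd u upperHalfPlaneSet) {B M : ℝ}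
    (hB : ∀ z ∈ upperHalfPlaneSet, u z ≤ B) (E : Finset ℝ)
    (hbdry : ∀ x : ℝ, x ∉ E → ∀ ε : ℝ, 0 < ε → ∀ᶠ z in 𝓝[upperHalfPlaneSet] (x : ℂ), u z ≤ M + ε) :
    ∀ z ∈ upperHalfPlaneSet, u z ≤ M := by
  classical
  set Ec : Finset ℂ := E.image (fun p : ℝ ↦ (p : ℂ)) with hEc
  have hEc : ∀ p ∈ Ec, p ∉ upperHalfPlaneSet := by
    intro p hp
    obtain ⟨q, -, rfl⟩ := Finset.mem_image.1 hp
    show ¬ (0 < (q : ℂ).im)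
    simp
  set L : ℂ → ℝ := fun z ↦ ∑ p ∈ Ec, Real.log ‖z - p‖ with hL
  set b : ℂ → ℝ := fun z ↦ Real.log ‖z + I‖ with hb
  set n : ℝ := (Ec.card : ℝ) + 1 with hn
  set C : ℝ := ∑ p ∈ Ec, Real.log (1 + ‖p + I‖) with hC
  have hC0 : 0 ≤ C := Finset.sum_nonneg fun p _ ↦ Real.log_nonneg (by linarith [norm_nonneg (p + I)])
  have hL_harm : HarmonicOnNhd L upperHalfPlaneSet := harmonicOnNhd_sum_log_norm_sub Ec hEc
  have hb_harm : HarmonicOnNhd b upperHalfPlaneSet := by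
    intro z hz
    have : HarmonicAt (fun w : ℂ ↦ Real.log ‖w - (-I)‖) z := by
      refine harmonicAt_log_norm_sub fun h ↦ ?_
      have : (0 : ℝ) < (-I).im := h ▸ hz
      norm_num at this
    simpa [hb, sub_neg_eq_add] using this
  -- the correction `K = L - n b` is bounded above by `C` and tends to `-∞` at `E` and at `∞`
  have hLb : ∀ z : ℂ, 0 ≤ z.im → L z ≤ (Ec.card : ℝ) * b z + C := by
    intro z hz
    calc L z ≤ ∑ p ∈ Ec, (Real.log ‖z + I‖ + Real.log (1 + ‖p + I‖)) :=
          Finset.sum_le_sum fun p _ ↦ log_norm_sub_le hz p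
      _ = (Ec.card : ℝ) * b z + C := by
          rw [Finset.sum_add_distrib, Finset.sum_const, nsmul_eq_mul, hb, hC]
  have hK : ∀ z : ℂ, 0 ≤ z.im → L z - n * b z ≤ C - b z := by
    intro z hz
    have := hLb z hz
    rw [hn]; nlinarith [log_norm_add_I_nonneg hz]
  have hKC : ∀ z : ℂ, 0 ≤ z.im → L z - n * b z ≤ C := fun z hz ↦
    (hK z hz).trans (by linarith [log_norm_add_I_nonneg hz])
  -- the claim for every `ε > 0`
  have key : ∀ ε : ℝ, 0 < ε → ∀ z ∈ upperHalfPlaneSet, u z + ε * (L z - n * b z) ≤ M + ε * C := by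
    intro ε hε
    have hv : HarmonicOnNhd (fun z ↦ u z + ε * (L z - n * b z)) upperHalfPlaneSet := by
      have h1 : HarmonicOnNhd (fun z ↦ L z - n * b z) upperHalfPlaneSet := by
        have := hL_harm.sub (hb_harm.const_smul (c := n))
        simpa [Pi.sub_def, Pi.smul_def, smul_eq_mul] using this
      have := hu.add (h1.const_smul (c := ε))
      simpa [Pi.add_def, Pi.smul_def, smul_eq_mul] using this
    refine harmonic_le_of_frontier_of_cocompact UpperHalfPlane.isOpen_upperHalfPlaneSet
      (convex_halfSpace_im_gt 0).isPreconnected hv (M := M + ε * C) ?_ ?_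
    · -- finite boundary points
      intro ζ hζ ε' hε'
      rw [show upperHalfPlaneSet = {z : ℂ | 0 < z.im} from rfl, frontier_setOf_lt_im] at hζ
      have hζim : ζ.im = 0 := hζ
      have hζre : ((ζ.re : ℝ) : ℂ) = ζ := by apply Complex.ext <;> simp [hζim]
      by_cases hζE : ζ.re ∈ E
      · -- an exceptional point: the barrier wins
        have hζEc : ζ ∈ Ec := Finset.mem_image.2 ⟨ζ.re, hζE, hζre⟩
        -- `u + ε K ≤ B + ε C' + ε log ‖z - ζ‖` near `ζ`, with `C' = C` (the other poles)
        have hrest : ∀ z : ℂ, 0 < z.im → L z - n * b z ≤ Real.log ‖z - ζ‖ + C := by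
          intro z hz
          have hsplit : L z = Real.log ‖z - ζ‖ + ∑ p ∈ Ec.erase ζ, Real.log ‖z - p‖ := by
            rw [hL]; exact (Finset.add_sum_erase Ec (fun p ↦ Real.log ‖z - p‖) hζEc).symm
          have h2 : ∑ p ∈ Ec.erase ζ, Real.log ‖z - p‖ ≤ ((Ec.erase ζ).card : ℝ) * b z + C := by
            calc ∑ p ∈ Ec.erase ζ, Real.log ‖z - p‖
                ≤ ∑ p ∈ Ec.erase ζ, (Real.log ‖z + I‖ + Real.log (1 + ‖p + I‖)) :=
                  Finset.sum_le_sum fun p _ ↦ log_norm_sub_le hz.le p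
              _ = ((Ec.erase ζ).card : ℝ) * b z + ∑ p ∈ Ec.erase ζ, Real.log (1 + ‖p + I‖) := by
                  rw [Finset.sum_add_distrib, Finset.sum_const, nsmul_eq_mul, hb]
              _ ≤ ((Ec.erase ζ).card : ℝ) * b z + C := by
                  gcongr
                  refine Finset.sum_le_sum_of_subset_of_nonneg (Finset.erase_subset _ _) ?_
                  intro p _ _
                  exact Real.log_nonneg (by linarith [norm_nonneg (p + I)])
          have hcard : ((Ec.erase ζ).card : ℝ) ≤ n := by
            rw [hn]; exact_mod_cast (Finset.card_erase_le).trans (Nat.le_succ _)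
          have hbz := log_norm_add_I_nonneg hz.le
          rw [hsplit]
          nlinarith
        set T : ℝ := (M - B) / ε - C with hT
        have hball : ∀ z ∈ upperHalfPlaneSet, ‖z - ζ‖ < Real.exp T → u z + ε * (L z - n * b z) ≤ M + ε * C := by
          intro z hz hzT
          have hzζ : z ≠ ζ := fun h ↦ by
            have : (0 : ℝ) < ζ.im := h ▸ hz
            rw [hζim] at this; exact lt_irrefl _ this
          have hn0 : 0 < ‖z - ζ‖ := norm_pos_iff.2 (sub_ne_zero.2 hzζ)
          have hlogT : Real.log ‖z - ζ‖ ≤ T :=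
            (Real.log_le_log hn0 hzT.le).trans (by rw [Real.log_exp])
          have h1 := hrest z hz
          have h2 : ε * (L z - n * b z) ≤ ε * (T + C) :=
            mul_le_mul_of_nonneg_left (by linarith) hε.le
          have h3 : ε * (T + C) = M - B := by rw [hT]; field_simp; ring
          linarith [hB z hz, mul_nonneg hε.le hC0]
        have hmem : upperHalfPlaneSet ∩ ball ζ (Real.exp T) ∈ 𝓝[upperHalfPlaneSet] ζ :=
          inter_mem_nhdsWithin _ (ball_mem_nhds ζ (Real.exp_pos T))
        filter_upwards [hmem] with z hz
        have := hball z hz.1 (by rw [← dist_eq_norm]; exact mem_ball.1 hz.2)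
        linarith
      · have h := hbdry ζ.re hζE ε' hε'
        rw [hζre] at h
        filter_upwards [h, self_mem_nhdsWithin] with z hz hzU
        have := mul_le_mul_of_nonneg_left (hKC z (le_of_lt hzU)) hε.le
        linarith
    · -- at infinity: `-ε b → -∞`
      intro ε' hε'
      rw [Filter.eventually_inf_principal]
      have hR : ∀ᶠ z in cocompact ℂ, Real.exp ((B - M) / ε + C) + 1 < ‖z‖ := by
        filter_upwards [(isCompact_closedBall (0 : ℂ) (Real.exp ((B - M) / ε + C) + 1)).compl_mem_cocompact]
          with z hz
        have : ¬ dist z 0 ≤ Real.exp ((B - M) / ε + C) + 1 := fun h ↦ hz (mem_closedBall.2 h)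
        rw [dist_zero_right] at this
        exact lt_of_not_ge this
      filter_upwards [hR] with z hz hzU
      have hzim : 0 < z.im := hzU
      have hbz : (B - M) / ε + C < b z := by
        rw [hb]
        have h1 : Real.exp ((B - M) / ε + C) < ‖z + I‖ := by
          have : ‖z‖ ≤ ‖z + I‖ + 1 := by
            calc ‖z‖ = ‖(z + I) - I‖ := by ring_nf
              _ ≤ ‖z + I‖ + ‖I‖ := norm_sub_le _ _
              _ = ‖z + I‖ + 1 := by rw [norm_I]
          linarith
        have := Real.log_lt_log (Real.exp_pos _) h1
        rwa [Real.log_exp] at this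
      have h2 := hK z hzim.le
      have h3 : ε * (L z - n * b z) ≤ ε * (C - b z) := mul_le_mul_of_nonneg_left h2 hε.le
      have h4 : ε * (C - b z) < M - B := by
        have := mul_lt_mul_of_pos_left hbz hε
        rw [show ε * ((B - M) / ε + C) = (B - M) + ε * C by field_simp] at this
        linarith
      linarith [hB z hzU, mul_nonneg hε.le hC0]
  -- `ε → 0`
  intro z hz
  set Kz : ℝ := L z - n * b z with hKz
  refine le_of_forall_pos_lt_add fun η hη ↦ ?_
  have hε : 0 < η / (|Kz| + C + 1) := div_pos hη (by positivity)
  have h := key _ hε z hz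
  have h2 : η / (|Kz| + C + 1) * (C - Kz) < η := by
    rw [div_mul_eq_mul_div, div_lt_iff₀ (by positivity)]
    nlinarith [neg_abs_le Kz, le_abs_self Kz]
  nlinarith [h, h2]

/-! ### The harmonic measure of `[-1, 1]` in the upper half-plane -/

/-- **The harmonic measure of the segment `[-1, 1]` seen from `w ∈ ℍ`**:
`ω(w) = (arg(w - 1) - arg(w + 1))/π`, the angle subtended by the segment over `π`. [folklore] -/
def hmSeg (w : ℂ) : ℝ := (arg (w - 1) - arg (w + 1)) / Real.pi

/-- `w ↦ arg (w - a)` is harmonic on `ℍ` for real `a` (the imaginary part of `log (w - a)`).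
[folklore] -/
theorem harmonicOnNhd_arg_sub_ofReal (a : ℝ) : HarmonicOnNhd (fun w : ℂ ↦ arg (w - a)) upperHalfPlaneSet := by
  intro w hw
  have hwim : 0 < w.im := hw
  have hslit : w - a ∈ slitPlane := Or.inr (by simp; exact hwim.ne')
  have han : AnalyticAt ℂ (fun z : ℂ ↦ Complex.log (z - a)) w :=
    (analyticAt_id.sub analyticAt_const).clog hslit
  have h := han.harmonicAt_im
  have heq : (fun z : ℂ ↦ (Complex.log (z - a)).im) = fun z ↦ arg (z - a) := by
    funext z; exact Complex.log_im _
  rwa [heq] at h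

/-- `ω` is harmonic on `ℍ`. [folklore] -/
theorem harmonicOnNhd_hmSeg : HarmonicOnNhd hmSeg upperHalfPlaneSet := by
  have h1 : HarmonicOnNhd (fun w : ℂ ↦ arg (w - 1)) upperHalfPlaneSet := by
    simpa using harmonicOnNhd_arg_sub_ofReal 1
  have h2 : HarmonicOnNhd (fun w : ℂ ↦ arg (w + 1)) upperHalfPlaneSet := by
    simpa [sub_neg_eq_add] using harmonicOnNhd_arg_sub_ofReal (-1)
  have h3 := (h1.sub h2).const_smul (c := Real.pi⁻¹)
  have heq : hmSeg = Real.pi⁻¹ • ((fun w : ℂ ↦ arg (w - 1)) - fun w : ℂ ↦ arg (w + 1)) := by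
    funext w
    simp only [hmSeg, Pi.smul_apply, Pi.sub_apply, smul_eq_mul]
    ring
  rw [heq]; exact h3

/-- `|ω| ≤ 2`. [folklore] -/
theorem abs_hmSeg_le (w : ℂ) : |hmSeg w| ≤ 2 := by
  rw [hmSeg, abs_div, abs_of_pos Real.pi_pos, div_le_iff₀ Real.pi_pos]
  calc |arg (w - 1) - arg (w + 1)| ≤ |arg (w - 1)| + |arg (w + 1)| := abs_sub _ _
    _ ≤ Real.pi + Real.pi := add_le_add (abs_arg_le_pi _) (abs_arg_le_pi _)
    _ = 2 * Real.pi := by ring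

/-- `arg (w - a) → 0` as `w → x` in `ℍ`, for real `x > a`. [folklore] -/
theorem tendsto_arg_sub_of_lt {a x : ℝ} (h : a < x) :
    Tendsto (fun w : ℂ ↦ arg (w - a)) (𝓝[upperHalfPlaneSet] (x : ℂ)) (𝓝 0) := by
  have hxa : (x : ℂ) - a = ((x - a : ℝ) : ℂ) := by push_cast; ring
  have hslit : (x : ℂ) - a ∈ slitPlane := by rw [hxa, ofReal_mem_slitPlane]; linarith
  have h0 : arg ((x : ℂ) - a) = 0 := by rw [hxa, arg_ofReal_of_nonneg (by linarith)]
  have hcont : Tendsto arg (𝓝 ((x : ℂ) - a)) (𝓝 0) := h0 ▸ (continuousAt_arg hslit).tendsto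
  have hsub : Tendsto (fun w : ℂ ↦ w - a) (𝓝 (x : ℂ)) (𝓝 ((x : ℂ) - a)) :=
    (continuous_id.sub continuous_const).tendsto _
  exact (hcont.comp hsub).mono_left nhdsWithin_le_nhds

/-- `arg (w - a) → π` as `w → x` in `ℍ`, for real `x < a`. [folklore] -/
theorem tendsto_arg_sub_of_gt {a x : ℝ} (h : x < a) :
    Tendsto (fun w : ℂ ↦ arg (w - a)) (𝓝[upperHalfPlaneSet] (x : ℂ)) (𝓝 Real.pi) := by
  have key := tendsto_arg_nhdsWithin_im_nonneg_of_re_neg_of_im_zero (z := (x : ℂ) - a)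
    (by simp; linarith) (by simp)
  refine key.comp ?_
  refine tendsto_nhdsWithin_of_tendsto_nhds_of_eventually_within _ ?_ ?_
  · exact ((continuous_id.sub continuous_const).tendsto (x : ℂ)).mono_left nhdsWithin_le_nhds
  · filter_upwards [self_mem_nhdsWithin] with w hw
    have hwim : 0 < w.im := hw
    show 0 ≤ (w - a).im
    simp; exact hwim.le

/-- **Boundary values of `ω` on `|x| > 1`, right part**: `ω → 0` at real `x > 1`. [folklore] -/
theorem tendsto_hmSeg_of_one_lt {x : ℝ} (hx : 1 < x) : Tendsto hmSeg (𝓝[upperHalfPlaneSet] (x : ℂ)) (𝓝 0) := by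
  have h1 : Tendsto (fun w : ℂ ↦ arg (w - 1)) (𝓝[upperHalfPlaneSet] (x : ℂ)) (𝓝 0) := by
    simpa using tendsto_arg_sub_of_lt (a := 1) hx
  have h2 : Tendsto (fun w : ℂ ↦ arg (w + 1)) (𝓝[upperHalfPlaneSet] (x : ℂ)) (𝓝 0) := by
    simpa [sub_neg_eq_add] using tendsto_arg_sub_of_lt (a := -1) (by linarith)
  have := (h1.sub h2).div_const Real.pi
  change Tendsto (fun w : ℂ ↦ (arg (w - 1) - arg (w + 1)) / Real.pi) _ _
  simpa using this

/-- **Boundary values of `ω` on `|x| > 1`, left part**: `ω → 0` at real `x < -1`. [folklore] -/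
theorem tendsto_hmSeg_of_lt_neg_one {x : ℝ} (hx : x < -1) :
    Tendsto hmSeg (𝓝[upperHalfPlaneSet] (x : ℂ)) (𝓝 0) := by
  have h1 : Tendsto (fun w : ℂ ↦ arg (w - 1)) (𝓝[upperHalfPlaneSet] (x : ℂ)) (𝓝 Real.pi) := by
    simpa using tendsto_arg_sub_of_gt (a := 1) (by linarith)
  have h2 : Tendsto (fun w : ℂ ↦ arg (w + 1)) (𝓝[upperHalfPlaneSet] (x : ℂ)) (𝓝 Real.pi) := by
    simpa [sub_neg_eq_add] using tendsto_arg_sub_of_gt (a := -1) hx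
  have := (h1.sub h2).div_const Real.pi
  change Tendsto (fun w : ℂ ↦ (arg (w - 1) - arg (w + 1)) / Real.pi) _ _
  simpa using this

/-- **Boundary values of `ω` on `(-1, 1)`**: `ω → 1` at real `|x| < 1`. [folklore] -/
theorem tendsto_hmSeg_of_abs_lt_one {x : ℝ} (hx : |x| < 1) :
    Tendsto hmSeg (𝓝[upperHalfPlaneSet] (x : ℂ)) (𝓝 1) := by
  rw [abs_lt] at hx
  have h1 : Tendsto (fun w : ℂ ↦ arg (w - 1)) (𝓝[upperHalfPlaneSet] (x : ℂ)) (𝓝 Real.pi) := by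
    simpa using tendsto_arg_sub_of_gt (a := 1) hx.2
  have h2 : Tendsto (fun w : ℂ ↦ arg (w + 1)) (𝓝[upperHalfPlaneSet] (x : ℂ)) (𝓝 0) := by
    simpa [sub_neg_eq_add] using tendsto_arg_sub_of_lt (a := -1) hx.1
  have := (h1.sub h2).div_const Real.pi
  rw [sub_zero, div_self Real.pi_pos.ne'] at this
  change Tendsto (fun w : ℂ ↦ (arg (w - 1) - arg (w + 1)) / Real.pi) _ _
  exact this

/-- **Identification of the two-valued bounded harmonic function.** A bounded harmonic function
`u` on `ℍ` with boundary values `0` on `(-1, 1)` and `1` on `|x| > 1`, outside a finite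
exceptional set `E` of real points, is `1 - ω` (Lindelöf's maximum principle
`harmonic_le_of_real_except` applied to `±(u - (1 - ω))`, exceptional set `E ∪ {±1}`). This is
the continuum function of the three-arc mixed problem of Lawler–Schramm–Werner (2004),
Prop. 4.1/4.2, after the substitution `z = w²` and even reflection.
[cite: LawlerSchrammWerner2004, Prop. 4.2 (proof, arXiv p. 22)] -/
theorem eq_one_sub_hmSeg {u : ℂ → ℝ} (hu : HarmonicOnNhd u upperHalfPlaneSet) {B : ℝ} (hB : ∀ z ∈ upperHalfPlaneSet, |u z| ≤ B)
    (E : Finset ℝ) (h0 : ∀ x : ℝ, x ∉ E → |x| < 1 → Tendsto u (𝓝[upperHalfPlaneSet] (x : ℂ)) (𝓝 0))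
    (h1 : ∀ x : ℝ, x ∉ E → 1 < |x| → Tendsto u (𝓝[upperHalfPlaneSet] (x : ℂ)) (𝓝 1)) :
    ∀ z ∈ upperHalfPlaneSet, u z = 1 - hmSeg z := by
  classical
  set d : ℂ → ℝ := fun z ↦ u z - (1 - hmSeg z) with hd
  have hd_harm : HarmonicOnNhd d upperHalfPlaneSet := by
    have hc : HarmonicOnNhd (fun _ : ℂ ↦ (1 : ℝ)) upperHalfPlaneSet := fun z _ ↦ harmonicAt_const 1
    exact hu.sub (hc.sub harmonicOnNhd_hmSeg)
  have hd_bd : ∀ z ∈ upperHalfPlaneSet, |d z| ≤ B + 3 := fun z hz ↦ by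
    have h1 := hB z hz
    have h2 := abs_hmSeg_le z
    rw [hd]
    calc |u z - (1 - hmSeg z)| ≤ |u z| + |1 - hmSeg z| := abs_sub _ _
      _ ≤ |u z| + (|(1 : ℝ)| + |hmSeg z|) := by gcongr; exact abs_sub _ _
      _ ≤ B + 3 := by rw [abs_one]; linarith
  set E' : Finset ℝ := insert 1 (insert (-1) E) with hE'
  have hd_lim : ∀ x : ℝ, x ∉ E' → Tendsto d (𝓝[upperHalfPlaneSet] (x : ℂ)) (𝓝 0) := by
    intro x hx
    simp only [hE', Finset.mem_insert, not_or] at hx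
    obtain ⟨hx1, hxm1, hxE⟩ := hx
    have hne : |x| ≠ 1 := by
      intro h
      rcases abs_eq (zero_le_one' ℝ) |>.1 h with h' | h'
      · exact hx1 h'
      · exact hxm1 h'
    rcases lt_or_gt_of_ne hne with hlt | hgt
    · have := (h0 x hxE hlt).sub ((tendsto_const_nhds (x := (1 : ℝ))).sub (tendsto_hmSeg_of_abs_lt_one hlt))
      rw [hd]
      simpa using this
    · have hω : Tendsto hmSeg (𝓝[upperHalfPlaneSet] (x : ℂ)) (𝓝 0) := by
        rcases lt_or_gt_of_ne (show x ≠ 0 from fun h ↦ by rw [h, abs_zero] at hgt; linarith)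
          with hneg | hpos
        · exact tendsto_hmSeg_of_lt_neg_one (by rw [abs_of_neg hneg] at hgt; linarith)
        · exact tendsto_hmSeg_of_one_lt (by rwa [abs_of_pos hpos] at hgt)
      have := (h1 x hxE hgt).sub ((tendsto_const_nhds (x := (1 : ℝ))).sub hω)
      rw [hd]
      simpa using this
  have hle : ∀ (f : ℂ → ℝ), HarmonicOnNhd f upperHalfPlaneSet → (∀ z ∈ upperHalfPlaneSet, |f z| ≤ B + 3) →
      (∀ x : ℝ, x ∉ E' → Tendsto f (𝓝[upperHalfPlaneSet] (x : ℂ)) (𝓝 0)) → ∀ z ∈ upperHalfPlaneSet, f z ≤ 0 := by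
    intro f hf hfb hfl
    refine harmonic_le_of_real_except hf (B := B + 3) (fun z hz ↦ (le_abs_self _).trans (hfb z hz)) E' ?_
    intro x hx ε hε
    have hev : ∀ᶠ z in 𝓝[upperHalfPlaneSet] (x : ℂ), f z < 0 + ε :=
      hfl x hx (Iio_mem_nhds (by linarith : (0 : ℝ) < 0 + ε))
    exact hev.mono fun z hz ↦ hz.le
  intro z hz
  have h1 := hle d hd_harm hd_bd hd_lim z hz
  have h2 := hle (fun w ↦ -d w) hd_harm.neg (fun w hw ↦ by rw [abs_neg]; exact hd_bd w hw)
    (fun x hx ↦ by simpa using (hd_lim x hx).neg) z hz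
  have : d z = 0 := by linarith
  rw [hd] at this
  linarith

end Literature.Analysis.Complex
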